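import Summits.RiemannHypothesis.RiemannHypothesis.Theorems.SemilocalNegCertSixtyOneKinked2107PiecesA
import Summits.RiemannHypothesis.RiemannHypothesis.Theorems.SemilocalNegCertSixtyOneKinked2107PiecesB
import Summits.RiemannHypothesis.RiemannHypothesis.Theorems.HandoffLadderRungOne
import Summits.RiemannHypothesis.RiemannHypothesis.Theorems.HandoffUpperClausesC
import Summits.RiemannHypothesis.RiemannHypothesis.Theorems.SemilocalClassLaw
import Summits.RiemannHypothesis.RiemannHypothesis.Theorems.SemilocalLogAtomsE
import HarnessLib

/-!
# Semi-local threshold of the `{∞,2,…,61}` form, negative side: `a*({2,…,61}) ≤ 1079 / 512 = 2.107421875` — the wall `q = 67` from a KINKED (piecewise-cubic) witness with slope breaks at the prime-atom images (part 26/26: the composition of the piece facts and the THEOREMS)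

Cell `rh-explicit` (HOME `run/shared/lean/pub/rh-explicit/`), seat cc-s2-9 gen3 (HUMAN RULING D-0074 (D5) WEIL data engine; LADDER-RH column WEIL, rung DATA → W-P(P2);
pipeline = cc-s2-4 gen8/gen11's piecewise-witness layer `SemilocalPiecewise{Witness,Increment,IncrementSum,Cert}.lean` + their float finder, every number
re-derived by an independent second engine E2 before filing; gen0/gen2 rows: `SemilocalNegCert{ThirteenKinked1423,…,FiftyThreeKinked2044}*`, capstone `SemilocalKinkedWallOffsets`).
HONEST FRAMING: RH-FREE theorems about the tree's `weilSemilocalThreshold S` of a TRUNCATED Weil form (finitely many places); nothing here bears on the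
truth of RH; the lower clause `(log q)/2 ≤ a*(S_q)` at all primes IS RH and is untouched; the SIGN of `δ*(67)` is not claimed.

KINKED row for the wall `q = 67` (`S = {2,…,61}`): at `b = 1079 / 512 = 2.107421875 ≈ a*(S_67) + 0.0050` (DATA, two engines, cc-s2-6/cc-s2-3: `a*(S_67) = 2.1023719`)
the polynomial × indicator class is far from negative (tree row `545/256`, `SemilocalNegCertUptoSixtyOneFinal`, `δ*(67) ≤ 0.0266`), whereas an odd piecewise cubic with slope breaks at the images
`|b − log n|` (rounded to `/1024`) of the atoms `n ∈ {3,5,7,11,13,17,19,23,29,31,37,41,43,47,53,59,61}` (the odd-prime atoms; all atom images resp. all primes resp. primes + 4 + 9 scanned, kit j257393) is negative by `4.308e-03·‖G‖²`.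
Instance: `S = {2, 3, 5, 7, 11, 13, 17, 19, 23, 29, 31, 37, 41, 43, 47, 53, 59, 61}`, `N = 70` (atom table `atomsUptoSixtyOne` / `atomsEnclose_UptoSixtyOne` of `SemilocalNegCertUptoSixtyOne.lean`), 18 pieces of degree ≤ 3, 340 `t`-pieces;
TWO ENGINES on the witness before the kernel: cc-s2-4's float finder `λ_min = -4.3083e-03` and the seat's exact-in-`x` decimal engine E2 `R = -4.3190e-03` (no polar credit);
the exact kernel margin is the certificate's own rational arithmetic (farm report).  ⇒ **`a*({2,…,61}) ≤ 1079 / 512`, `δ*(67) < 0.005076`** (was `0.0266`).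
No data is trusted: every bound is a `decide +kernel` fact.  Folklore throughout.
-/

set_option autoImplicit false
set_option linter.dupNamespace false  -- the mandated namespace repeats `RiemannHypothesis`
set_option Elab.async false  -- serialise the kernel facts: in parallel they exhaust the node's per-process heap (cc-s2-4 gen11, CC4-LEAN §16.10)

noncomputable section

open Complex Filter Set MeasureTheory Topology
open scoped Real

namespace Summit.RiemannHypothesis.RiemannHypothesis.Theorems.SemilocalPolyWitness

open MeasureTheory Set Finset Real
open Literature.NumberTheory.LFunctions
open Summit.RiemannHypothesis.RiemannHypothesis.Theorems.MotivicDoor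
open Summit.RiemannHypothesis.RiemannHypothesis.Theorems.MotivicDoor.SemilocalThreshold
open Summit.RiemannHypothesis.RiemannHypothesis.Theorems.MotivicDoor.SemilocalMarkov
open LQ

set_option maxRecDepth 4000 in  -- `i < cuts.length` unfolds a 340-element list
/-- all 340 pieces of `certSixtyOneKinked2107` check (the two half-range compositions `check_SixtyOneKinked2107_piecesA/B`). -/
theorem check_SixtyOneKinked2107_pieces : ∀ i, i < certSixtyOneKinked2107.cuts.length → certSixtyOneKinked2107.checkPiecePW i = true := by
  intro i hi
  have hi' : i < 340 := hi
  by_cases h : i < 177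
  · exact check_SixtyOneKinked2107_piecesA i h
  · exact check_SixtyOneKinked2107_piecesB i (Nat.not_lt.mp h) hi'

/-! ### The theorems -/

open Summit.RiemannHypothesis.RiemannHypothesis.Theorems.HandoffMarginLaw (wallOffset)

/-- **`a*(2,…,61) ≤ 1079 / 512 = 2.107421875`** — the wall `q = 67` from the KINKED witness (the tree's polynomial row:
`545/256`, `SemilocalNegCertUptoSixtyOneFinal`). RH-free. -/
theorem weilSemilocalThreshold_uptoSixtyOne_le_2107 :
    weilSemilocalThreshold {2, 3, 5, 7, 11, 13, 17, 19, 23, 29, 31, 37, 41, 43, 47, 53, 59, 61} ≤ ((1079 / 512 : ℚ) : ℝ) :=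
  weilSemilocalThreshold_le_of_checkPW_sharp certSixtyOneKinked2107 atomsEnclose_UptoSixtyOne
    check_SixtyOneKinked2107_main check_SixtyOneKinked2107_atoms check_SixtyOneKinked2107_pieces

/-- Failure form: positivity of the `{∞,2,…,61}` form fails on every cone `C(B)`, `B > 1079 / 512`. -/
theorem not_weilSemilocalPositivityOn_uptoSixtyOne_of_gt_2107 {B : ℝ} (hB : (1079 / 512 : ℝ) < B) :
    ¬ WeilSemilocalPositivityOn {2, 3, 5, 7, 11, 13, 17, 19, 23, 29, 31, 37, 41, 43, 47, 53, 59, 61} B := by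
  rw [not_weilSemilocalPositivityOn_iff_weilSemilocalThreshold_lt]
  have h := weilSemilocalThreshold_uptoSixtyOne_le_2107
  push_cast at h
  linarith

/-- **`a*(S) ≤ 1079 / 512` for every finite `S` of least missing prime `67`** (`{p < 67} ⊆ S ∌ 67`; the class of `67`, by first-gap locality
`SemilocalClassLaw.weilSemilocalThreshold_eq_of_classLawAt'` at the PROVED instance `semilocalClassLawAt_sixtyseven`). -/
theorem weilSemilocalThreshold_le_2107_of_mem {S : Finset ℕ} (hS : ∀ p : ℕ, p.Prime → p < 67 → p ∈ S) (h67 : 67 ∉ S) :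
    weilSemilocalThreshold S ≤ ((1079 / 512 : ℚ) : ℝ) := by
  rw [SemilocalClassLaw.weilSemilocalThreshold_eq_of_classLawAt' (by norm_num) hS h67 SemilocalClassLaw.semilocalClassLawAt_sixtyseven,
    HandoffUpperClauses.primesBelow_sixtyseven]
  exact weilSemilocalThreshold_uptoSixtyOne_le_2107

/-- `a*(S_67) ≤ 1079 / 512` in the `Nat.primesBelow` currency of the handoff / class-law files. -/
theorem weilSemilocalThreshold_primesBelow_sixtyseven_le_2107 :
    weilSemilocalThreshold (Nat.primesBelow 67) ≤ ((1079 / 512 : ℚ) : ℝ) := by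
  rw [HandoffUpperClauses.primesBelow_sixtyseven]
  exact weilSemilocalThreshold_uptoSixtyOne_le_2107

/-- **Two-sided KERNEL bracket of the class of `67`**: `1 ≤ a*(S) ≤ 1079 / 512` for every finite `S` with `{p < 67} ⊆ S ∌ 67`
(lower end: the `a = 1` rung through locality, `HandoffLadderRungOne.one_le_wall_of_ge_eight`; DATA `a*(S_67) = 2.1023719`). RH-free. -/
theorem weilSemilocalThreshold_mem_Icc_one_2107 {S : Finset ℕ} (hS : ∀ p : ℕ, p.Prime → p < 67 → p ∈ S) (h67 : 67 ∉ S) :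
    weilSemilocalThreshold S ∈ Set.Icc (1 : ℝ) ((1079 / 512 : ℚ) : ℝ) := by
  rw [SemilocalClassLaw.weilSemilocalThreshold_eq_of_classLawAt' (by norm_num) hS h67 SemilocalClassLaw.semilocalClassLawAt_sixtyseven]
  exact ⟨HandoffLadderRungOne.one_le_wall_of_ge_eight (N := 67) (by norm_num), weilSemilocalThreshold_primesBelow_sixtyseven_le_2107⟩

/-- **The wall offset in the kernel**: `δ*(67) = a*(S_67) − (log 67)/2 ≤ 1079 / 512 − (log 67)/2` (the polynomial row gave `545/256 − (log 67)/2`).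
RH-free; the SIGN of `δ*(67)` is not claimed here. -/
theorem wallOffset_sixtyseven_le_2107 : wallOffset 67 ≤ 1079 / 512 - Real.log 67 / 2 := by
  have h := weilSemilocalThreshold_uptoSixtyOne_le_2107
  push_cast at h
  rw [wallOffset, HandoffUpperClauses.primesBelow_sixtyseven]
  push_cast
  linarith

/-- … numerically: **`δ*(67) < 0.005076`** (the tree's polynomial row: `0.0266`; DATA, two engines: `δ*(67) ≈ 2.6e-05`). RH-free. -/
theorem wallOffset_sixtyseven_lt_005076 : wallOffset 67 < 0.005076 := by
  have h := wallOffset_sixtyseven_le_2107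
  have hl := log_sixtyseven_gt
  linarith

end Summit.RiemannHypothesis.RiemannHypothesis.Theorems.SemilocalPolyWitness

end
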